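import Summits.QuantumFields.YangMills.Theorems.BalabanUVNodesN15CovariantLandauLeibnizRows
import HarnessLib

/-!
# Route «BalabanUVNodes», node N15 = NE2, road (c) — PROGRAMME (P-S), XVIII: THE TRANSPOSED LEIBNIZ RULE — `Bᵀ∂ = 𝔰_{(div_n W)ᵀ} − ∂ᵀℭ_Wᵀ` for `B = 𝔇_W S` — by which the former
# Calderón–Zygmund obstruction `G′(1)Bᵀ∂` becomes `G′(1)𝔰′ − [G′(1)∂ᵀ]ℭ_Wᵀ` (flat ADJOINT row × local letters); the transposed local operators and their rows (dag-n15-c g23, n15-c∕227;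
# HOME HANDOFF «BRICK D — REFINED PLAN»)

Cell `pub-ymgap`, seat `pub-ymgap-dag-n15-c` (generation g23; R134 (a), s1; HUMAN RULING D-0062; chair R424 venue).  `bears_on: R4∕N15 · K3⁸ SpineGivenEndpointR13SepCoPHV
(stmt-QuantumFields-27366)`; filed `--supports stmt-QuantumFields-27366 --as helper` — COUNT-NEUTRAL.  Theorems only; 0 `sorry`.  Imports BY NAME n15-c∕224–225 (`bMulShift`, `bContr`, `sDiag`,
`bDiv`, `cgrad_mulVec`, `cgrad_one_transpose_mulVec`, row lemmas' pattern), n15-c∕213 (`hasMaj_mulVecLin_of_sum_abs_le`), n15-c∕215 (`le_mul_exp_of_dist_le_one`).  Nothing modified.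

WHY.  In the fixed point `G′(T) = G′(1) + G′(1)(Δ′(1) − Δ′(T))G′(T)` the word `G′(1)·Bᵀ∂` (`B = ∂ − D_T = n𝔇_{1−T}S`) has no n-uniform sup-block row when split as `[G′(1)Bᵀ]·∂`; transposing
n15-c∕224's Leibniz rule gives `Bᵀ∂ = 𝔰_{V′} − ∂ᵀ·ℭ_Wᵀ` (`V′(z) = ((div_n W)(z))ᵀ`), so `G′(1)Bᵀ∂ = G′(1)𝔰_{V′} − [G′(1)∂ᵀ]·ℭ_Wᵀ`: the flat ADJOINT row `C_A` (PROVED, n15-c∕220) times local letters.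
Identities are stated as ACTIONS on fields (`*ᵥ`) — see n15-c∕224's note on `CStarMatrix`'s `HMul` instance.
* §1 `bMulShift_transpose_mulVec`, `bContr_transpose_mulVec`, `sDiag_transpose`, `bMulShift_col_le`; ★★ `bMulShift_transpose_mulVec_cgrad_one` (the transposed Leibniz rule).
* §2 rows: ★ `hasMaj_bMulShift_transpose` (BV → BS, `(d+1)w′e^{θ}e^{−θd}`), ★ `hasMaj_bContr_transpose` (BS → BV, `w′`), with `w′` the COLUMN letter of `W`.

HONEST FRAMING ∕ LIMITS.  Finite-dimensional identities and elementary rows ([folklore]); MODEL carriers; NOT [Balaban1985BackgroundPropagators] Lemma 3.3 as printed; NE2⁺ NOT PRINTED; N15 of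
record untouched (DISCHARGED AS CONSUMED, p687738); counts UNMOVED (typed 28∕28 · discharged 8∕27); one finite 𝕋⁴ at fixed ε per index — NOT infinite volume ∕ OS ∕ mass gap ∕ Clay.
-/

noncomputable section

open scoped BigOperators Matrix
open Finset

namespace Summit.QuantumFields.YangMills.BalabanUVNodes.N15.CovLandau

open Literature.MathematicalPhysics.QuantumFieldTheory.Balaban1983to89
open Literature.MathematicalPhysics.QuantumFieldTheory.Balaban1983to89.B5Prop11Plancherel (Tor fine unitVec)
open Literature.MathematicalPhysics.QuantumFieldTheory.Balaban1983to89.B11SectG (BlockNorm HasMaj)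
open Literature.MathematicalPhysics.QuantumFieldTheory.Balaban1983to89.B6UnitTorusCarrier (unitTorusGeo)
open Literature.MathematicalPhysics.QuantumFieldTheory.Balaban1983to89.T4EtaRateCoeffDefect (fibre mem_fibre)
open Literature.MathematicalPhysics.QuantumFieldTheory.King1986.Torus (blockOf tdistT tdistT_nonneg tdistT_self tdistT_symm)
open Summit.QuantumFields.YangMills.BalabanUVNodes.N15.MatrixSpecies (liftBlk)
open Summit.QuantumFields.YangMills.BalabanUVNodes.N15.VectorPiece (tdistT_blockOf_sub_unitVec_le)
open Summit.QuantumFields.YangMills.BalabanUVNodes.N15.BlockRows (hasMaj_mulVecLin_of_sum_abs_le)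

variable {d : ℕ}

section Local

variable (M : Fin (d + 1) → ℕ) [∀ μ, NeZero (M μ)] (n : ℕ) [NeZero n] {ι : Type} [Fintype ι] [DecidableEq ι] (L k : ℕ)

/-! ## §1 The transposed local operators and the transposed Leibniz rule -/

omit [DecidableEq ι] in
/-- `(𝔇_W S)ᵀ` pointwise: `((𝔇_W S)ᵀω)(z, i) = Σ_μ Σ_j W_μ(z − e_μ)_{ji} ω((z − e_μ, μ), j)`. [folklore] -/
theorem bMulShift_transpose_mulVec (W : Fin (d + 1) → Tor (fine n M) → Matrix ι ι ℝ) (ω : (Tor (fine n M) × Fin (d + 1)) × ι → ℝ) (z : Tor (fine n M)) (i : ι) :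
    ((bMulShift M n W)ᵀ *ᵥ ω) (z, i) = ∑ μ, ∑ j, W μ (z - unitVec (fine n M) μ) j i * ω ((z - unitVec (fine n M) μ, μ), j) := by
  classical
  simp only [Matrix.mulVec, dotProduct, Matrix.transpose_apply, bMulShift]
  rw [Fintype.sum_prod_type, Fintype.sum_prod_type, Finset.sum_comm]
  refine Finset.sum_congr rfl fun μ _ => ?_
  have hx : ∀ x : Tor (fine n M), (z = x + unitVec (fine n M) μ) ↔ (x = z - unitVec (fine n M) μ) := fun x =>
    ⟨fun h => by rw [h, add_sub_cancel_right], fun h => by rw [h, sub_add_cancel]⟩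
  rw [Finset.sum_comm]
  refine Finset.sum_congr rfl fun j _ => ?_
  simp_rw [hx, ite_mul, zero_mul]
  rw [Finset.sum_ite_eq' Finset.univ]
  simp

omit [DecidableEq ι] in
/-- `ℭ_Wᵀ` pointwise: `(ℭ_Wᵀ f)((z, μ), i) = Σ_j W_μ(z)_{ji} f(z, j)` (site fields to bond fields, same site). [folklore] -/
theorem bContr_transpose_mulVec (W : Fin (d + 1) → Tor (fine n M) → Matrix ι ι ℝ) (f : Tor (fine n M) × ι → ℝ) (z : Tor (fine n M)) (μ : Fin (d + 1)) (i : ι) :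
    ((bContr M n W)ᵀ *ᵥ f) ((z, μ), i) = ∑ j, W μ z j i * f (z, j) := by
  classical
  simp only [Matrix.mulVec, dotProduct, Matrix.transpose_apply, bContr]
  rw [Fintype.sum_prod_type]
  simp only [ite_mul, zero_mul]
  rw [Finset.sum_eq_single z (fun x _ hx => by simp [Ne.symm hx]) (fun h => absurd (Finset.mem_univ _) h)]
  simp

omit [∀ μ, NeZero (M μ)] [NeZero n] [Fintype ι] [DecidableEq ι] in
/-- `𝔰_Vᵀ = 𝔰_{Vᵀ}`. [folklore] -/
theorem sDiag_transpose (V : Tor (fine n M) → Matrix ι ι ℝ) : (sDiag M n V)ᵀ = sDiag M n (fun z => (V z)ᵀ) := by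
  ext q q'
  simp only [Matrix.transpose_apply, sDiag]
  by_cases h : q.1 = q'.1
  · rw [if_pos h, if_pos h.symm, h]
  · rw [if_neg h, if_neg (Ne.symm h)]

/-- ★★ **THE TRANSPOSED LEIBNIZ RULE**: `(𝔇_W S)ᵀ(∂f) = 𝔰_{(div_n W)ᵀ}f − ∂ᵀ(ℭ_Wᵀ f)`. [cite: Balaban1985BackgroundPropagators, (3.58)–(3.62) p.402 (where the smoothness of the field enters)] -/
theorem bMulShift_transpose_mulVec_cgrad_one (W : Fin (d + 1) → Tor (fine n M) → Matrix ι ι ℝ) (f : Tor (fine n M) × ι → ℝ) :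
    (bMulShift M n W)ᵀ *ᵥ ((cgrad M n (fun (_ : Fin (d + 1)) (_ : Tor (fine n M)) => (1 : Matrix ι ι ℝ))) *ᵥ f) = sDiag M n (fun z => (bDiv M n W z)ᵀ) *ᵥ f - (cgrad M n (fun (_ : Fin (d + 1)) (_ : Tor (fine n M)) => (1 : Matrix ι ι ℝ)))ᵀ *ᵥ ((bContr M n W)ᵀ *ᵥ f) := by
  funext p
  obtain ⟨z, i⟩ := p
  simp only [Pi.sub_apply, bMulShift_transpose_mulVec, sDiag_mulVec, cgrad_one_transpose_mulVec, bContr_transpose_mulVec, cgrad_mulVec, Matrix.one_apply, ite_mul, one_mul,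
    zero_mul, Finset.sum_ite_eq, Finset.mem_univ, if_true, sub_add_cancel, bDiv, Matrix.transpose_apply, Matrix.sum_apply, Matrix.smul_apply, Matrix.sub_apply, smul_eq_mul,
    Finset.sum_mul]
  have h1 : (∑ j, ∑ μ, (n : ℝ) * (W μ (z - unitVec (fine n M) μ) j i - W μ z j i) * f (z, j)) =
      ∑ μ, ∑ j, (n : ℝ) * (W μ (z - unitVec (fine n M) μ) j i - W μ z j i) * f (z, j) := Finset.sum_comm
  rw [h1, ← Finset.sum_sub_distrib]
  refine Finset.sum_congr rfl fun μ _ => ?_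
  rw [mul_sub, Finset.mul_sum, Finset.mul_sum, ← Finset.sum_sub_distrib, ← Finset.sum_sub_distrib]
  refine Finset.sum_congr rfl fun j _ => ?_
  ring

/-! ## §2 The rows of the transposed local operators -/

omit [DecidableEq ι] in
/-- total row of `(𝔇_W S)ᵀ` = column sum of `𝔇_W S` (column letter `w′` of `W`). [folklore] -/
theorem bMulShift_col_le (W : Fin (d + 1) → Tor (fine n M) → Matrix ι ι ℝ) {w' : ℝ} (hw : ∀ μ x i, ∑ j, |W μ x j i| ≤ w') (q : Tor (fine n M) × ι) :
    ∑ p, |bMulShift M n W p q| ≤ ((d : ℝ) + 1) * w' := by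
  classical
  rw [Fintype.sum_prod_type, Fintype.sum_prod_type, Finset.sum_comm]
  simp only [bMulShift]
  have hx : ∀ (μ : Fin (d + 1)) (x : Tor (fine n M)), (q.1 = x + unitVec (fine n M) μ) ↔ (x = q.1 - unitVec (fine n M) μ) := fun μ x =>
    ⟨fun h => by rw [h, add_sub_cancel_right], fun h => by rw [h, sub_add_cancel]⟩
  calc ∑ μ, ∑ x, ∑ j, |if q.1 = x + unitVec (fine n M) μ then W μ x j q.2 else 0|
      = ∑ μ, ∑ j, |W μ (q.1 - unitVec (fine n M) μ) j q.2| := by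
        refine Finset.sum_congr rfl fun μ _ => ?_
        rw [Finset.sum_comm]
        refine Finset.sum_congr rfl fun j _ => ?_
        simp_rw [hx μ, apply_ite (fun x : ℝ => |x|), abs_zero]
        rw [Finset.sum_ite_eq' Finset.univ]; simp
    _ ≤ ∑ _μ : Fin (d + 1), w' := Finset.sum_le_sum fun μ _ => hw μ _ q.2
    _ = ((d : ℝ) + 1) * w' := by rw [Finset.sum_const, Finset.card_univ, Fintype.card_fin, nsmul_eq_mul]; push_cast; ring

/-- ★ **`(𝔇_W S)ᵀ : BV → BS` has the row `(d+1)w′·e^{θ}·e^{−θd}`** (`w′` the column letter of `W`; the source bond `(z − e_μ, μ)` lies in a block at distance `≤ 1`). [folklore] -/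
theorem hasMaj_bMulShift_transpose (W : Fin (d + 1) → Tor (fine n M) → Matrix ι ι ℝ) {w' θ : ℝ} (hw0 : 0 ≤ w') (hθ : 0 ≤ θ) (hw : ∀ μ x i, ∑ j, |W μ x j i| ≤ w') :
    HasMaj (BlockNorm.ofBlocks (unitTorusGeo L k M) (liftBlk (fun b : Tor (fine n M) × Fin (d + 1) => blockOf n M b.1) ι)) (BlockNorm.ofBlocks (unitTorusGeo L k M) (liftBlk (blockOf n M) ι)) (Matrix.mulVecLin (bMulShift M n W)ᵀ) (fun y y' => ((d : ℝ) + 1) * w' * Real.exp θ * Real.exp (-(θ * tdistT M y y'))) := by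
  classical
  refine hasMaj_mulVecLin_of_sum_abs_le _ _ (fun y y' => by positivity) fun q w'' => ?_
  change ∑ p ∈ fibre (liftBlk (fun b : Tor (fine n M) × Fin (d + 1) => blockOf n M b.1) ι) w'', |(bMulShift M n W)ᵀ q p| ≤
    ((d : ℝ) + 1) * w' * Real.exp θ * Real.exp (-(θ * tdistT M (blockOf n M q.1) w''))
  by_cases hb : tdistT M (blockOf n M q.1) w'' ≤ 1
  · calc ∑ p ∈ fibre (liftBlk (fun b : Tor (fine n M) × Fin (d + 1) => blockOf n M b.1) ι) w'', |(bMulShift M n W)ᵀ q p| ≤ ∑ p, |(bMulShift M n W)ᵀ q p| :=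
          Finset.sum_le_univ_sum_of_nonneg fun p => abs_nonneg _
      _ = ∑ p, |bMulShift M n W p q| := by simp only [Matrix.transpose_apply]
      _ ≤ ((d : ℝ) + 1) * w' := bMulShift_col_le M n W hw q
      _ ≤ ((d : ℝ) + 1) * w' * Real.exp θ * Real.exp (-(θ * tdistT M (blockOf n M q.1) w'')) := le_mul_exp_of_dist_le_one (by positivity) hθ hb
  · refine le_trans (le_of_eq (Finset.sum_eq_zero fun p hp => ?_)) (by positivity)
    have hp1 : blockOf n M p.1.1 = w'' := (mem_fibre (liftBlk (fun b : Tor (fine n M) × Fin (d + 1) => blockOf n M b.1) ι) w'' p).1 hp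
    have : ¬ q.1 = p.1.1 + unitVec (fine n M) p.1.2 := by
      intro h
      apply hb
      have e1 : p.1.1 = q.1 - unitVec (fine n M) p.1.2 := by rw [h, add_sub_cancel_right]
      rw [← hp1, e1]
      rw [tdistT_symm]
      exact tdistT_blockOf_sub_unitVec_le (M := M) (n := n) q.1 p.1.2
    simp [bMulShift, Matrix.transpose_apply, this]

omit [DecidableEq ι] in
/-- total row of `ℭ_Wᵀ`. [folklore] -/
theorem bContr_transpose_row_le (W : Fin (d + 1) → Tor (fine n M) → Matrix ι ι ℝ) {w' : ℝ} (hw : ∀ μ x i, ∑ j, |W μ x j i| ≤ w') (p : (Tor (fine n M) × Fin (d + 1)) × ι) :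
    ∑ q, |(bContr M n W)ᵀ p q| ≤ w' := by
  classical
  rw [Fintype.sum_prod_type]
  simp only [Matrix.transpose_apply, bContr]
  rw [Finset.sum_eq_single p.1.1 (fun z _ hz => by simp [Ne.symm hz]) (fun h => absurd (Finset.mem_univ _) h)]
  simp only [if_true]
  exact hw p.1.2 p.1.1 p.2

/-- ★ **`ℭ_Wᵀ : BS → BV` has the row `w′·e^{−θd}`** (same block). [folklore] -/
theorem hasMaj_bContr_transpose (W : Fin (d + 1) → Tor (fine n M) → Matrix ι ι ℝ) {w' θ : ℝ} (hw0 : 0 ≤ w') (hw : ∀ μ x i, ∑ j, |W μ x j i| ≤ w') :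
    HasMaj (BlockNorm.ofBlocks (unitTorusGeo L k M) (liftBlk (blockOf n M) ι)) (BlockNorm.ofBlocks (unitTorusGeo L k M) (liftBlk (fun b : Tor (fine n M) × Fin (d + 1) => blockOf n M b.1) ι)) (Matrix.mulVecLin (bContr M n W)ᵀ) (fun y y' => w' * Real.exp (-(θ * tdistT M y y'))) := by
  classical
  refine hasMaj_mulVecLin_of_sum_abs_le _ _ (fun y y' => by positivity) fun p w'' => ?_
  change ∑ q ∈ fibre (liftBlk (blockOf n M) ι) w'', |(bContr M n W)ᵀ p q| ≤ w' * Real.exp (-(θ * tdistT M (blockOf n M p.1.1) w''))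
  by_cases hb : blockOf n M p.1.1 = w''
  · calc ∑ q ∈ fibre (liftBlk (blockOf n M) ι) w'', |(bContr M n W)ᵀ p q| ≤ ∑ q, |(bContr M n W)ᵀ p q| := Finset.sum_le_univ_sum_of_nonneg fun q => abs_nonneg _
      _ ≤ w' := bContr_transpose_row_le M n W hw p
      _ = w' * Real.exp (-(θ * tdistT M (blockOf n M p.1.1) w'')) := by rw [← hb, tdistT_self, mul_zero, neg_zero, Real.exp_zero, mul_one]
  · refine le_trans (le_of_eq (Finset.sum_eq_zero fun q hq => ?_)) (by positivity)
    have hq1 : blockOf n M q.1 = w'' := (mem_fibre (liftBlk (blockOf n M) ι) w'' q).1 hq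
    have : ¬ p.1.1 = q.1 := fun h => hb (by rw [h]; exact hq1)
    simp [bContr, Matrix.transpose_apply, this]

end Local

end Summit.QuantumFields.YangMills.BalabanUVNodes.N15.CovLandau

end
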